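import Mathlib
import HarnessLib
import Summits.Ventures.LatticeQCDFlow.Exactness.NCMCGeneralSpaceEstimatorChebyshev

/-!
# The errors of the free-energy estimate are asymmetric: exponential tails for over- and under-shoots at finite `N`

HONEST FRAMING: exact (Metropolis-corrected) sampling algorithms for lattice gauge theory;
figures of merit are autocorrelation/cost numbers at stated couplings and volumes; no
continuum-physics claim.

Venture `LatticeQCDFlow` (cell pub-lqcd), topic `Exactness`; FANOUT row 13 (`eng-snf`, GEN-14).
NEW WORK of the cell (elementary: Markov's inequality, and a one-sided Chernoff bound for
NON-NEGATIVE square-integrable variables that needs only the second moment), not a published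
result; nothing is cited as a fact (C. Jarzynski 1997 and H. Chernoff 1952 named only).
Continuation of `NCMCGeneralSpaceEstimatorChebyshev.lean` (GEN-12: the two-sided, distribution-free
`P{|ΔF̂_N − ΔF| ≥ −log(1 − ε)} ≤ (1/ESS_F − 1)/(Nε²)`).  The Jarzynski weights `e^{−W}` are
unbounded above but bounded BELOW by `0`; this file exploits the sign: UNDERSHOOTS of `ΔF̂` (the
exponential average too large) are controlled by Markov's inequality at every `N`, OVERSHOOTS (the
exponential average too small — the typical failure of a dissipative protocol that misses the rare
low-work events) by an exponential bound in `N · ESS_F`.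

## Setting and content

`μ` a probability law on records, `w ≥ 0` measurable in `L²(μ)` with `θ = E_μ w`, `m₂ = E_μ w²`,
`N ≥ 1` i.i.d. records `Measure.pi (fun _ : Fin N => μ)`, `w̄_N = sampleMean w`,
`ΔF̂_N = jarzynskiEstimate w = −log w̄_N`.

* **`mgf_neg_le_exp`** — LOWER-TAIL MGF BOUND: `E_μ e^{−λw} ≤ exp(−λθ + λ²m₂/2)` for `λ ≥ 0`
  (pointwise `e^{−y} ≤ 1 − y + y²/2` for `y ≥ 0`, from Mathlib's `1 + y + y²/2 ≤ e^{y}` and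
  `(1 + y + y²/2)(1 − y + y²/2) = 1 + y⁴/4`).
* **`measureReal_sampleMean_le_sub_le_exp`** — `μ^{⊗N}{w̄_N ≤ θ − t} ≤ exp(−N t²/(2m₂))`, `t > 0`
  (Chernoff at `λ = t/m₂` on `Σ −w`).
* **`measureReal_mul_le_sampleMean_le`** — MARKOV: `μ^{⊗N}{w̄_N ≥ κθ} ≤ 1/κ` for `κ > 0`, `θ > 0`.
* For a Crooks pair `(κF, κR, s, e, W)` from `ν₀` to `ν₁` with `e^{−ΔF} = Z₁/Z₀`, `N ≥ 1`
  independent forward evolutions, `ESS_F = (E_F e^{−W})²/E_F e^{−2W}`, `δ > 0`: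
  **`CrooksPair.measureReal_jarzynskiEstimate_le_sub_le`** — UNDERSHOOTS, ANY `N`:
  `P{ΔF̂_N ≤ ΔF − δ} ≤ e^{−δ}` (Markov: `E w̄_N = e^{−ΔF}`);
  **`CrooksPair.measureReal_le_jarzynskiEstimate_sub_le_exp`** — OVERSHOOTS (`e^{−W} ∈ L²(P_F)`):
  `P{ΔF̂_N ≥ ΔF + δ} ≤ exp(−N · ESS_F · (1 − e^{−δ})²/2)`, and the same with
  `ESS_F = 1/E_F[e^{−2(W−ΔF)}]` (`…_dissipation`); **`…_le_of_le`** — SAMPLE-SIZE RULE: if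
  `2 log(1/p) ≤ N · ESS_F · (1 − e^{−δ})²` then that probability is `≤ p`.
  Reading for the engine (`estimators.free_energy`, the `ess` column): a reported `dF` from `N`
  independent evolutions UNDERSTATES `ΔF` by more than `δ` with probability at most `e^{−δ}`
  whatever `N` and the protocol, and OVERSTATES it by more than `δ` with probability at most
  `exp(−N·ESS_F(1 − e^{−δ})²/2)` — e.g. `≤ p` once `N·ESS_F ≥ 2 log(1/p)/(1 − e^{−δ})²`.

Scope / NOT CLAIMED: independent evolutions only; `ESS_F` is the POPULATION Kish fraction (not the
reported `ess/N`); neither bound is claimed sharp; no value for any concrete protocol.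
-/

namespace Summit.Ventures.LatticeQCDFlow.Exactness.GeneralNCMC

open MeasureTheory ProbabilityTheory Set Filter Finset
open scoped ENNReal NNReal Topology

variable {E : Type*} [MeasurableSpace E]

section IID

variable (μ : Measure E) [IsProbabilityMeasure μ]

/-! ## A one-sided Chernoff bound for non-negative variables with two moments -/

/-- **Lower-tail MGF bound**: for a measurable `w ≥ 0` in `L²(μ)` and `λ ≥ 0`,
`E_μ e^{−λw} ≤ exp(−λ E_μ w + λ² E_μ w²/2)`. -/
theorem mgf_neg_le_exp {w : E → ℝ} (hwm : Measurable w) (hw0 : ∀ a, 0 ≤ w a) (hL2 : MemLp w 2 μ)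
    {t : ℝ} (ht : 0 ≤ t) :
    mgf (fun a => -w a) μ t ≤ Real.exp (-(t * ∫ a, w a ∂μ) + t ^ 2 * (∫ a, w a ^ 2 ∂μ) / 2) := by
  have hwi : Integrable w μ := hL2.integrable one_le_two
  -- pointwise: `e^{−y} ≤ 1 − y + y²/2` for `y ≥ 0`
  have hE : ∀ y : ℝ, 0 ≤ y → Real.exp (-y) ≤ 1 - y + y ^ 2 / 2 := by
    intro y hy
    have hq := Real.quadratic_le_exp_of_nonneg hy
    have hpos : 0 < 1 + y + y ^ 2 / 2 := by positivity
    rw [Real.exp_neg]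
    calc (Real.exp y)⁻¹ ≤ (1 + y + y ^ 2 / 2)⁻¹ := inv_anti₀ hpos hq
      _ ≤ 1 - y + y ^ 2 / 2 := by
          rw [inv_le_iff_one_le_mul₀' hpos]
          have hid : (1 + y + y ^ 2 / 2) * (1 - y + y ^ 2 / 2) = 1 + y ^ 4 / 4 := by ring
          rw [hid]
          have : 0 ≤ y ^ 4 / 4 := by positivity
          linarith
  have hpt : ∀ a, Real.exp (t * -w a) ≤ 1 - t * w a + t ^ 2 * w a ^ 2 / 2 := fun a => by
    have h := hE (t * w a) (mul_nonneg ht (hw0 a))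
    rw [show t * -w a = -(t * w a) by ring]
    calc Real.exp (-(t * w a)) ≤ 1 - t * w a + (t * w a) ^ 2 / 2 := h
      _ = 1 - t * w a + t ^ 2 * w a ^ 2 / 2 := by ring
  have hexpint : Integrable (fun a => Real.exp (t * -w a)) μ := by
    refine Integrable.of_bound (Real.measurable_exp.comp (hwm.neg.const_mul t)).aestronglyMeasurable
      1 (Eventually.of_forall fun a => ?_)
    rw [Real.norm_eq_abs, abs_of_nonneg (Real.exp_pos _).le, Real.exp_le_one_iff]
    nlinarith [hw0 a]
  have hrhs : Integrable (fun a => 1 - t * w a + t ^ 2 * w a ^ 2 / 2) μ :=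
    ((integrable_const 1).sub (hwi.const_mul t)).add ((hL2.integrable_sq.const_mul (t ^ 2)).div_const 2)
  calc mgf (fun a => -w a) μ t = ∫ a, Real.exp (t * -w a) ∂μ := rfl
    _ ≤ ∫ a, (1 - t * w a + t ^ 2 * w a ^ 2 / 2) ∂μ := integral_mono hexpint hrhs hpt
    _ = 1 - t * (∫ a, w a ∂μ) + t ^ 2 * (∫ a, w a ^ 2 ∂μ) / 2 := by
        have e1 : ∫ a, (1 - t * w a + t ^ 2 * w a ^ 2 / 2) ∂μ =
            ∫ a, (1 - t * w a) ∂μ + ∫ a, t ^ 2 * w a ^ 2 / 2 ∂μ :=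
          integral_add ((integrable_const 1).sub (hwi.const_mul t))
            ((hL2.integrable_sq.const_mul (t ^ 2)).div_const 2)
        have e2 : ∫ a, (1 - t * w a) ∂μ = ∫ _a, (1 : ℝ) ∂μ - ∫ a, t * w a ∂μ :=
          integral_sub (integrable_const 1) (hwi.const_mul t)
        rw [e1, e2, integral_const, smul_eq_mul, probReal_univ, one_mul, integral_const_mul,
          integral_div, integral_const_mul]
    _ ≤ Real.exp (-(t * ∫ a, w a ∂μ) + t ^ 2 * (∫ a, w a ^ 2 ∂μ) / 2) := by
        linarith [Real.add_one_le_exp (-(t * ∫ a, w a ∂μ) + t ^ 2 * (∫ a, w a ^ 2 ∂μ) / 2)]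

/-- **Lower-tail bound for the sample mean of non-negative records.**  For a measurable `w ≥ 0` in
`L²(μ)` with `E_μ w² > 0`, `N ≥ 1` i.i.d. records and `t > 0`:
`μ^{⊗N} {(1/N) Σ_i w(y i) ≤ E_μ w − t} ≤ exp(−N t²/(2 E_μ w²))`. -/
theorem measureReal_sampleMean_le_sub_le_exp {w : E → ℝ} (hwm : Measurable w)
    (hw0 : ∀ a, 0 ≤ w a) (hL2 : MemLp w 2 μ) (hm2 : 0 < ∫ a, w a ^ 2 ∂μ) {N : ℕ} (hN : 0 < N)
    {t : ℝ} (ht : 0 < t) :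
    (Measure.pi fun _ : Fin N => μ).real {y | sampleMean w y ≤ (∫ a, w a ∂μ) - t} ≤
      Real.exp (-(N * t ^ 2 / (2 * ∫ a, w a ^ 2 ∂μ))) := by
  set P := Measure.pi fun _ : Fin N => μ with hP
  set θ := ∫ a, w a ∂μ with hθdef
  set m2 := ∫ a, w a ^ 2 ∂μ with hm2def
  set l := t / m2 with hl
  have hl0 : 0 < l := div_pos ht hm2
  -- independence and the one-coordinate MGF bound
  have hindep : iIndepFun (fun (i : Fin N) (y : Fin N → E) => -w (y i)) P :=
    iIndepFun_pi (μ := fun _ : Fin N => μ) (X := fun _ : Fin N => fun a => -w a)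
      fun _ => hwm.neg.aemeasurable
  have hmgf_i : ∀ i : Fin N,
      mgf (fun y : Fin N → E => -w (y i)) P l ≤ Real.exp (-(l * θ) + l ^ 2 * m2 / 2) := by
    intro i
    have hid : mgf (fun y : Fin N → E => -w (y i)) P l = mgf (fun a => -w a) μ l :=
      integral_comp_eval_pi μ i (Real.measurable_exp.comp (hwm.neg.const_mul l)).aestronglyMeasurable
    rw [hid]
    exact mgf_neg_le_exp μ hwm hw0 hL2 hl0.le
  have hsum : (∑ i : Fin N, fun y : Fin N → E => -w (y i)) = fun y => ∑ i, -w (y i) := by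
    funext y
    rw [Finset.sum_apply]
  have hmgf : mgf (fun y : Fin N → E => ∑ i, -w (y i)) P l ≤
      Real.exp (N * (-(l * θ) + l ^ 2 * m2 / 2)) := by
    rw [← hsum, hindep.mgf_sum₀ (fun i => (hwm.neg.comp (measurable_pi_apply i)).aemeasurable) univ]
    calc ∏ i, mgf (fun y : Fin N → E => -w (y i)) P l
        ≤ ∏ _i : Fin N, Real.exp (-(l * θ) + l ^ 2 * m2 / 2) :=
          Finset.prod_le_prod (fun i _ => mgf_nonneg) fun i _ => hmgf_i i
      _ = Real.exp (N * (-(l * θ) + l ^ 2 * m2 / 2)) := by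
          rw [Finset.prod_const, card_univ, Fintype.card_fin, ← Real.exp_nat_mul]
  -- integrability of `e^{l S}`, `S = Σ −w ≤ 0`
  have hSm : Measurable fun y : Fin N → E => ∑ i, -w (y i) :=
    Finset.measurable_sum _ fun i _ => hwm.neg.comp (measurable_pi_apply i)
  have hSint : Integrable (fun y : Fin N → E => Real.exp (l * ∑ i, -w (y i))) P := by
    refine Integrable.of_bound (Real.measurable_exp.comp (hSm.const_mul l)).aestronglyMeasurable 1
      (Eventually.of_forall fun y => ?_)
    rw [Real.norm_eq_abs, abs_of_nonneg (Real.exp_pos _).le, Real.exp_le_one_iff]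
    have hS : ∑ i, -w (y i) ≤ 0 :=
      Finset.sum_nonpos fun i _ => neg_nonpos.2 (hw0 (y i))
    nlinarith
  -- Chernoff
  have hcher := measure_ge_le_exp_mul_mgf (μ := P) (X := fun y : Fin N → E => ∑ i, -w (y i))
    (-(N * (θ - t))) hl0.le hSint
  have hNpos : (0 : ℝ) < N := by exact_mod_cast hN
  have hset : {y : Fin N → E | sampleMean w y ≤ θ - t} = {y | -(N * (θ - t)) ≤ ∑ i, -w (y i)} := by
    ext y
    simp only [mem_setOf_eq, sampleMean, Finset.sum_neg_distrib]
    rw [div_le_iff₀ hNpos, neg_le_neg_iff, mul_comm]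
  rw [hset]
  refine hcher.trans ?_
  have hm2' : m2 ≠ 0 := hm2.ne'
  calc Real.exp (-l * -(N * (θ - t))) * mgf (fun y : Fin N → E => ∑ i, -w (y i)) P l
      ≤ Real.exp (-l * -(N * (θ - t))) * Real.exp (N * (-(l * θ) + l ^ 2 * m2 / 2)) :=
        mul_le_mul_of_nonneg_left hmgf (Real.exp_pos _).le
    _ = Real.exp (-(N * t ^ 2 / (2 * m2))) := by
        rw [← Real.exp_add, hl]
        congr 1
        field_simp
        ring

/-- **Markov for the sample mean of non-negative records**: for an integrable `w ≥ 0` with mean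
`θ > 0`, `N ≥ 1` and `κ > 0`, `μ^{⊗N} {κθ ≤ (1/N) Σ_i w(y i)} ≤ 1/κ`. -/
theorem measureReal_mul_le_sampleMean_le {w : E → ℝ} (hw0 : ∀ a, 0 ≤ w a)
    (hwi : Integrable w μ) (hθ : 0 < ∫ a, w a ∂μ) {N : ℕ} (hN : 0 < N) {κ : ℝ} (hκ : 0 < κ) :
    (Measure.pi fun _ : Fin N => μ).real {y | κ * (∫ a, w a ∂μ) ≤ sampleMean w y} ≤ 1 / κ := by
  set P := Measure.pi fun _ : Fin N => μ with hP
  have hnn : 0 ≤ᵐ[P] fun y : Fin N → E => sampleMean w y :=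
    Eventually.of_forall fun y => div_nonneg (Finset.sum_nonneg fun i _ => hw0 (y i)) (Nat.cast_nonneg N)
  have hmarkov := mul_meas_ge_le_integral_of_nonneg hnn (integrable_sampleMean_pi μ hwi N)
    (κ * ∫ a, w a ∂μ)
  rw [integral_sampleMean_pi μ hwi hN] at hmarkov
  rw [le_div_iff₀ hκ]
  calc P.real {y | κ * (∫ a, w a ∂μ) ≤ sampleMean w y} * κ
      = (κ * (∫ a, w a ∂μ)) * P.real {y | κ * (∫ a, w a ∂μ) ≤ sampleMean w y} / (∫ a, w a ∂μ) := by
        field_simp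
    _ ≤ (∫ a, w a ∂μ) / (∫ a, w a ∂μ) := div_le_div_of_nonneg_right hmarkov hθ.le
    _ = 1 := div_self hθ.ne'

end IID

/-! ## For a Crooks pair: asymmetric finite-`N` tails of the free-energy estimate -/

namespace CrooksPair

variable {Ω : Type*} [MeasurableSpace Ω]
variable {ν₀ ν₁ : Measure Ω} {κF κR : Kernel Ω E} {s e : E → Ω} {W : E → ℝ}

/-- **Undershoots, any `N` (Markov).**  For every Crooks pair with `e^{−ΔF} = Z₁/Z₀`, `N ≥ 1`
independent forward evolutions from prior equilibrium and `δ > 0`: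
`P{ΔF̂_N ≤ ΔF − δ} ≤ e^{−δ}` — the estimate UNDERSTATES the free-energy difference by more than `δ`
only when the exponential average exceeds `e^{δ}` times its mean. -/
theorem measureReal_jarzynskiEstimate_le_sub_le [IsFiniteMeasure ν₀] [IsFiniteMeasure ν₁]
    [IsMarkovKernel κF] [IsMarkovKernel κR] (h0 : ν₀ univ ≠ 0)
    (h : CrooksPair ν₀ ν₁ κF κR s e W) {ΔF : ℝ}
    (hΔF : Real.exp (-ΔF) = ((ν₀ univ)⁻¹ * ν₁ univ).toReal) {N : ℕ} (hN : 0 < N) (δ : ℝ) :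
    haveI := isProbabilityMeasure_fwdPathLaw ν₀ h0 κF
    (Measure.pi fun _ : Fin N => fwdPathLaw ν₀ κF).real
        {y | jarzynskiEstimate (fun ε => Real.exp (-W ε)) y ≤ ΔF - δ} ≤ Real.exp (-δ) := by
  haveI := isProbabilityMeasure_fwdPathLaw ν₀ h0 κF
  set P := Measure.pi fun _ : Fin N => fwdPathLaw ν₀ κF with hP
  have hθ : ∫ ε, Real.exp (-W ε) ∂(fwdPathLaw ν₀ κF) = Real.exp (-ΔF) := by
    rw [h.integral_exp_neg_work, hΔF]
  have hθpos : 0 < ∫ ε, Real.exp (-W ε) ∂(fwdPathLaw ν₀ κF) := by rw [hθ]; exact Real.exp_pos _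
  have hmarkov := measureReal_mul_le_sampleMean_le (fwdPathLaw ν₀ κF) (fun ε => (Real.exp_pos _).le)
    (h.integrable_exp_neg_work h0) hθpos hN (Real.exp_pos δ)
  rw [one_div, ← Real.exp_neg] at hmarkov
  refine (measureReal_mono ?_).trans hmarkov
  intro y hy
  simp only [mem_setOf_eq, jarzynskiEstimate] at hy ⊢
  have hpos : 0 < sampleMean (fun ε => Real.exp (-W ε)) y := by
    unfold sampleMean
    haveI : Nonempty (Fin N) := Fin.pos_iff_nonempty.1 hN
    exact div_pos (Finset.sum_pos (fun i _ => Real.exp_pos _) Finset.univ_nonempty)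
      (by exact_mod_cast hN)
  rw [hθ, ← Real.exp_add, show δ + -ΔF = -(ΔF - δ) by ring, ← Real.le_log_iff_exp_le hpos]
  linarith

/-- **Overshoots: an exponential bound in `N · ESS_F`.**  For every Crooks pair with
`e^{−W} ∈ L²(P_F)` and `e^{−ΔF} = Z₁/Z₀`, `N ≥ 1` independent forward evolutions and `δ > 0`:
`P{ΔF̂_N ≥ ΔF + δ} ≤ exp(−N · ESS_F · (1 − e^{−δ})²/2)`, `ESS_F = (E_F e^{−W})²/E_F e^{−2W}`
(the event is `{w̄_N ≤ (1 − (1 − e^{−δ})) E w̄}`; the one-sided Chernoff bound for the non-negative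
weights needs only their second moment). -/
theorem measureReal_le_jarzynskiEstimate_sub_le_exp [IsFiniteMeasure ν₀] [IsFiniteMeasure ν₁]
    [IsMarkovKernel κF] [IsMarkovKernel κR] (h0 : ν₀ univ ≠ 0)
    (h : CrooksPair ν₀ ν₁ κF κR s e W)
    (hL2 : MemLp (fun ε => Real.exp (-W ε)) 2 (fwdPathLaw ν₀ κF)) {ΔF : ℝ}
    (hΔF : Real.exp (-ΔF) = ((ν₀ univ)⁻¹ * ν₁ univ).toReal) {N : ℕ} (hN : 0 < N) {δ : ℝ}
    (hδ : 0 < δ) :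
    haveI := isProbabilityMeasure_fwdPathLaw ν₀ h0 κF
    (Measure.pi fun _ : Fin N => fwdPathLaw ν₀ κF).real
        {y | ΔF + δ ≤ jarzynskiEstimate (fun ε => Real.exp (-W ε)) y} ≤
      Real.exp (-(N * ((∫ ε, Real.exp (-W ε) ∂(fwdPathLaw ν₀ κF)) ^ 2 /
        ∫ ε, Real.exp (-(2 * W ε)) ∂(fwdPathLaw ν₀ κF)) * (1 - Real.exp (-δ)) ^ 2 / 2)) := by
  haveI := isProbabilityMeasure_fwdPathLaw ν₀ h0 κF
  set P := Measure.pi fun _ : Fin N => fwdPathLaw ν₀ κF with hP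
  have hwm : Measurable fun ε => Real.exp (-W ε) := Real.measurable_exp.comp h.measurable_W.neg
  set θ := ∫ ε, Real.exp (-W ε) ∂(fwdPathLaw ν₀ κF) with hθdef
  have hθ : θ = Real.exp (-ΔF) := by rw [hθdef, h.integral_exp_neg_work, hΔF]
  have hθpos : 0 < θ := by rw [hθ]; exact Real.exp_pos _
  have hm2eq : ∫ ε, Real.exp (-W ε) ^ 2 ∂(fwdPathLaw ν₀ κF) =
      ∫ ε, Real.exp (-(2 * W ε)) ∂(fwdPathLaw ν₀ κF) :=
    integral_congr_ae (Eventually.of_forall fun ε => by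
      simp only
      rw [sq, ← Real.exp_add]
      congr 1
      ring)
  have hm2 : 0 < ∫ ε, Real.exp (-W ε) ^ 2 ∂(fwdPathLaw ν₀ κF) := by
    rw [integral_pos_iff_support_of_nonneg (fun ε => sq_nonneg _) hL2.integrable_sq]
    have hsupp : Function.support (fun ε => Real.exp (-W ε) ^ 2) = univ := by
      ext ε
      simp only [Function.mem_support, mem_univ, iff_true]
      exact (pow_pos (Real.exp_pos _) 2).ne'
    rw [hsupp, measure_univ]
    exact one_pos
  -- the deviation `t = θ (1 − e^{−δ}) > 0`
  have hexpδ : Real.exp (-δ) < 1 := Real.exp_lt_one_iff.2 (neg_neg_of_pos hδ)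
  have ht : 0 < θ * (1 - Real.exp (-δ)) := mul_pos hθpos (by linarith)
  have key := measureReal_sampleMean_le_sub_le_exp (fwdPathLaw ν₀ κF) hwm
    (fun ε => (Real.exp_pos _).le) hL2 hm2 hN ht
  have hset : {y : Fin N → E | ΔF + δ ≤ jarzynskiEstimate (fun ε => Real.exp (-W ε)) y} ⊆
      {y | sampleMean (fun ε => Real.exp (-W ε)) y ≤ θ - θ * (1 - Real.exp (-δ))} := by
    intro y hy
    simp only [mem_setOf_eq, jarzynskiEstimate] at hy ⊢
    have hpos : 0 < sampleMean (fun ε => Real.exp (-W ε)) y := by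
      unfold sampleMean
      haveI : Nonempty (Fin N) := Fin.pos_iff_nonempty.1 hN
      exact div_pos (Finset.sum_pos (fun i _ => Real.exp_pos _) Finset.univ_nonempty)
        (by exact_mod_cast hN)
    have hlog : Real.log (sampleMean (fun ε => Real.exp (-W ε)) y) ≤ -ΔF + -δ := by linarith
    rw [Real.log_le_iff_le_exp hpos, Real.exp_add] at hlog
    rw [show θ - θ * (1 - Real.exp (-δ)) = θ * Real.exp (-δ) by ring, hθ]
    exact hlog
  refine ((measureReal_mono hset).trans key).trans (le_of_eq ?_)
  rw [hm2eq]
  congr 1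
  ring

/-- **The same with `ESS_F = 1/E_F[e^{−2(W−ΔF)}]`**:
`P{ΔF̂_N ≥ ΔF + δ} ≤ exp(−N (1 − e^{−δ})² / (2 E_F[e^{−2(W−ΔF)}]))`. -/
theorem measureReal_le_jarzynskiEstimate_sub_le_exp_dissipation [IsFiniteMeasure ν₀]
    [IsFiniteMeasure ν₁] [IsMarkovKernel κF] [IsMarkovKernel κR] (h0 : ν₀ univ ≠ 0)
    (h1 : ν₁ univ ≠ 0) (h : CrooksPair ν₀ ν₁ κF κR s e W)
    (hL2 : MemLp (fun ε => Real.exp (-W ε)) 2 (fwdPathLaw ν₀ κF)) {ΔF : ℝ}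
    (hΔF : Real.exp (-ΔF) = ((ν₀ univ)⁻¹ * ν₁ univ).toReal) {N : ℕ} (hN : 0 < N) {δ : ℝ}
    (hδ : 0 < δ) :
    haveI := isProbabilityMeasure_fwdPathLaw ν₀ h0 κF
    (Measure.pi fun _ : Fin N => fwdPathLaw ν₀ κF).real
        {y | ΔF + δ ≤ jarzynskiEstimate (fun ε => Real.exp (-W ε)) y} ≤
      Real.exp (-(N * (1 - Real.exp (-δ)) ^ 2 /
        (2 * ∫ ε, Real.exp (-(2 * (W ε - ΔF))) ∂(fwdPathLaw ν₀ κF)))) := by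
  have key := h.measureReal_le_jarzynskiEstimate_sub_le_exp h0 hL2 hΔF hN hδ
  rw [h.essPop_eq_inv_dissipation h0 h1 hΔF] at key
  refine key.trans (le_of_eq ?_)
  congr 1
  ring

/-- **Sample-size rule for overshoots**: if `2 log(1/p) ≤ N · ESS_F · (1 − e^{−δ})²` (with
`ESS_F = 1/E_F[e^{−2(W−ΔF)}]`, `0 < p`), then `P{ΔF̂_N ≥ ΔF + δ} ≤ p`. -/
theorem measureReal_le_jarzynskiEstimate_sub_le_of_le [IsFiniteMeasure ν₀] [IsFiniteMeasure ν₁]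
    [IsMarkovKernel κF] [IsMarkovKernel κR] (h0 : ν₀ univ ≠ 0) (h1 : ν₁ univ ≠ 0)
    (h : CrooksPair ν₀ ν₁ κF κR s e W)
    (hL2 : MemLp (fun ε => Real.exp (-W ε)) 2 (fwdPathLaw ν₀ κF)) {ΔF : ℝ}
    (hΔF : Real.exp (-ΔF) = ((ν₀ univ)⁻¹ * ν₁ univ).toReal) {N : ℕ} (hN : 0 < N) {δ p : ℝ}
    (hδ : 0 < δ) (hp : 0 < p)
    (hNp : 2 * Real.log (1 / p) ≤ N * (1 / ∫ ε, Real.exp (-(2 * (W ε - ΔF))) ∂(fwdPathLaw ν₀ κF)) *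
      (1 - Real.exp (-δ)) ^ 2) :
    haveI := isProbabilityMeasure_fwdPathLaw ν₀ h0 κF
    (Measure.pi fun _ : Fin N => fwdPathLaw ν₀ κF).real
        {y | ΔF + δ ≤ jarzynskiEstimate (fun ε => Real.exp (-W ε)) y} ≤ p := by
  have key := h.measureReal_le_jarzynskiEstimate_sub_le_exp_dissipation h0 h1 hL2 hΔF hN hδ
  refine key.trans ?_
  rw [← Real.le_log_iff_exp_le hp]
  have hlog : Real.log (1 / p) = -Real.log p := by rw [one_div, Real.log_inv]
  rw [hlog] at hNp
  have hid : (N : ℝ) * (1 - Real.exp (-δ)) ^ 2 /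
      (2 * ∫ ε, Real.exp (-(2 * (W ε - ΔF))) ∂(fwdPathLaw ν₀ κF)) =
      N * (1 / ∫ ε, Real.exp (-(2 * (W ε - ΔF))) ∂(fwdPathLaw ν₀ κF)) * (1 - Real.exp (-δ)) ^ 2 / 2 := by
    ring
  rw [hid]
  linarith

end CrooksPair

end Summit.Ventures.LatticeQCDFlow.Exactness.GeneralNCMC
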